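import Mathlib
import Literature.NumberTheory.Sieve.Maynard2016Lemma7PerTuple
import HarnessLib

/-!
# Maynard 2016: arithmetic of the admissible tuple `h_j = p_{π(k)+j} P_w` for large `x`

Topic `Literature/NumberTheory/Sieve`. J. Maynard, *Large gaps between primes*, Ann. of Math. (2)
183 (2016), 915–933 = arXiv:1408.5110, §4 ("we let `x` be sufficiently large in terms of `k`", the
choice `w = log₄ x → ∞`, `h_j = p_{π(k)+j} P_w`) and §6, proof of Lemma 7 after (6.25): the
congruence `d_j ∣ p₀ + (h_j − h_i) q` determines `q` modulo `d_j` because every prime factor of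
`h_j − h_i` not dividing `P_w` would have to divide `p_{π(k)+j} − p_{π(k)+i}`, which is `< p_{π(k)+k} ≤ w`
once `x` is large in terms of `k`.

PROVED here (no named facts): `tendsto_wFun_atTop` (`w → ∞` along `x : ℕ`), `eventually_le_wFun`,
`hTuple_strictMono` (the `h_j` increase), `hTuple_sub_hTuple` (the difference is
`(p_{π(k)+j} − p_{π(k)+i}) P_w`), and `eventually_prime_dvd_Pw_of_dvd_hTuple_sub`: for all large `x`,
every prime dividing `h_j − h_i` (`i ≠ j`) divides `P_w`; equivalently a modulus coprime to `P_w` is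
coprime to every `h_j − h_i` (`eventually_coprime_hTuple_sub`).

## References

* J. Maynard, *Large gaps between primes*, Ann. of Math. (2) 183 (2016), 915–933; arXiv:1408.5110,
  §4 and Lemma 7 (proof). [Maynard2016LargeGaps]
-/

open Filter Finset
open scoped Topology

namespace Literature.NumberTheory.Sieve

namespace Maynard2016

/-- `w = log₄ x → ∞` along `x : ℕ`. [cite: Maynard2016LargeGaps, §4 (choice of w)] -/
theorem tendsto_wFun_atTop : Tendsto (fun x : ℕ => wFun x) atTop atTop := by
  have hT : Tendsto (fun X : ℝ => Real.log (Real.log (Real.log (Real.log X)))) atTop atTop :=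
    Real.tendsto_log_atTop.comp (Real.tendsto_log_atTop.comp
      (Real.tendsto_log_atTop.comp Real.tendsto_log_atTop))
  unfold wFun
  exact hT.comp tendsto_natCast_atTop_atTop

/-- Any constant is eventually `≤ w` ("`x` sufficiently large in terms of `k`").
[cite: Maynard2016LargeGaps, §4 (choice of w)] -/
theorem eventually_le_wFun (C : ℝ) : ∀ᶠ x : ℕ in atTop, C ≤ wFun x :=
  tendsto_wFun_atTop.eventually_ge_atTop C

/-- The `h_j` are strictly increasing in `j`. [cite: Maynard2016LargeGaps, §4 (definition of h_j)] -/
theorem hTuple_strictMono (k x : ℕ) : StrictMono (hTuple k x) := by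
  intro i j hij
  unfold hTuple
  exact Nat.mul_lt_mul_of_pos_right
    ((Nat.nth_strictMono Nat.infinite_setOf_prime) (by simpa using hij)) (primorial_pos _)

/-- `h_j − h_i = (p_{π(k)+j} − p_{π(k)+i}) · P_w` (over `ℤ`). [cite: Maynard2016LargeGaps, §4 (definition of h_j)] -/
theorem hTuple_sub_hTuple (k x : ℕ) (i j : Fin k) :
    (hTuple k x j : ℤ) - hTuple k x i =
      ((Nat.nth Nat.Prime (Nat.primeCounting k + j) : ℤ) -
        Nat.nth Nat.Prime (Nat.primeCounting k + i)) * (Pw x : ℤ) := by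
  unfold hTuple
  push_cast
  ring

/-- The prime `p_{π(k)+j}` is at most `p_{π(k)+k}` for `j < k`. [cite: Maynard2016LargeGaps, §4 (definition of h_j)] -/
theorem nth_prime_le_of_fin (k : ℕ) (j : Fin k) :
    Nat.nth Nat.Prime (Nat.primeCounting k + j) ≤ Nat.nth Nat.Prime (Nat.primeCounting k + k) :=
  (Nat.nth_monotone Nat.infinite_setOf_prime) (by omega)

/-- **For `x` large in terms of `k`, every prime factor of `h_j − h_i` (`i ≠ j`) divides `P_w`.**
[cite: Maynard2016LargeGaps, Lemma 7 (proof, the residue class of q modulo the lcm)] -/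
theorem eventually_prime_dvd_Pw_of_dvd_hTuple_sub (k : ℕ) :
    ∀ᶠ x : ℕ in atTop, ∀ i j : Fin k, i ≠ j → ∀ p : ℕ, p.Prime →
      (p : ℤ) ∣ (hTuple k x j : ℤ) - hTuple k x i → p ∣ Pw x := by
  filter_upwards [eventually_le_wFun (Nat.nth Nat.Prime (Nat.primeCounting k + k) : ℝ)] with x hx
  intro i j hij p hp hdvd
  rw [hTuple_sub_hTuple] at hdvd
  have hpZ : Prime (p : ℤ) := Nat.prime_iff_prime_int.mp hp
  rcases hpZ.dvd_or_dvd hdvd with h1 | h1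
  · -- `p ∣ p_{π(k)+j} − p_{π(k)+i} ≠ 0`, so `p ≤ p_{π(k)+k} ≤ w`
    have hne : ((Nat.nth Nat.Prime (Nat.primeCounting k + j) : ℤ) -
        Nat.nth Nat.Prime (Nat.primeCounting k + i)).natAbs ≠ 0 := by
      intro h0
      have h0' := Int.natAbs_eq_zero.1 h0
      have hEq : Nat.nth Nat.Prime (Nat.primeCounting k + j) =
          Nat.nth Nat.Prime (Nat.primeCounting k + i) := by exact_mod_cast sub_eq_zero.1 h0'
      have := (Nat.nth_injective Nat.infinite_setOf_prime) hEq
      exact hij (Fin.ext (by omega))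
    have hle : p ≤ ((Nat.nth Nat.Prime (Nat.primeCounting k + j) : ℤ) -
        Nat.nth Nat.Prime (Nat.primeCounting k + i)).natAbs :=
      Nat.le_of_dvd (Nat.pos_of_ne_zero hne) (Int.natCast_dvd.1 h1)
    have hle' : ((Nat.nth Nat.Prime (Nat.primeCounting k + j) : ℤ) -
        Nat.nth Nat.Prime (Nat.primeCounting k + i)).natAbs ≤
          Nat.nth Nat.Prime (Nat.primeCounting k + k) :=
      Int.natAbs_coe_sub_coe_le_of_le (nth_prime_le_of_fin k j) (nth_prime_le_of_fin k i)
    have hpw : (p : ℝ) ≤ wFun x :=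
      le_trans (by exact_mod_cast hle.trans hle') hx
    unfold Pw
    rw [hp.dvd_primorial_iff]
    exact Nat.le_floor hpw
  · exact Int.natCast_dvd_natCast.1 h1

/-- For `x` large in terms of `k`: a modulus coprime to `P_w` is coprime to every `h_j − h_i`, `i ≠ j`
(so `q ↦ p₀ + (h_j − h_i) q` is a bijection modulo it). [cite: Maynard2016LargeGaps, Lemma 7 (proof, the residue class of q modulo the lcm)] -/
theorem eventually_coprime_hTuple_sub (k : ℕ) :
    ∀ᶠ x : ℕ in atTop, ∀ i j : Fin k, i ≠ j → ∀ d : ℕ, Nat.Coprime d (Pw x) →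
      Nat.Coprime d ((hTuple k x j : ℤ) - hTuple k x i).natAbs := by
  filter_upwards [eventually_prime_dvd_Pw_of_dvd_hTuple_sub k] with x hx
  intro i j hij d hd
  rw [Nat.coprime_comm, Nat.Coprime]
  by_contra hne
  obtain ⟨p, hp, hpd⟩ := Nat.exists_prime_and_dvd hne
  have hp1 : p ∣ ((hTuple k x j : ℤ) - hTuple k x i).natAbs :=
    hpd.trans (Nat.gcd_dvd_left _ _)
  have hp2 : p ∣ d := hpd.trans (Nat.gcd_dvd_right _ _)
  have hp3 : p ∣ Pw x := hx i j hij p hp (Int.natCast_dvd.2 hp1)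
  have h1 : p ∣ Nat.gcd d (Pw x) := Nat.dvd_gcd hp2 hp3
  rw [hd] at h1
  exact hp.one_lt.ne' (Nat.dvd_one.1 h1)

end Maynard2016

end Literature.NumberTheory.Sieve
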